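import Summits.BirchSwinnertonDyer.BirchSwinnertonDyer.Theorems.CyclotomicUntwistC1OfPrint
import Summits.BirchSwinnertonDyer.BirchSwinnertonDyer.Theorems.CyclotomicUntwistInertiaWildAtThree
import Literature.NumberTheory.DiophantineGeometry.Conductor
import HarnessLib

/-!
# Crux child C1 `PSUntwistedLFunctionAtThree` ⟸ SIX NAMED PRINT FACTS, BY NAME (capstone (ii) of the print
# layer (T), lead file 5) — a CONDITIONAL result

Cell `pub/bsd-wall` (D-0145 line `route-BirchSwinnertonDyer-CyclotomicUntwist`), seat `bsd-line-cycu-p1`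
(K1/K2 LEAD lineage, gen 8). THEOREMS ONLY (no definition, no new named fact, no `sorry`). BSD is not proved by
this file; crux child C1 = stmt-BirchSwinnertonDyer-27548 is NOT closed by it: the theorem is CONDITIONAL on six
named print facts (Literature `def … : Prop`, taken as hypotheses — a `conditional-result` in the sense of D-0014),
and no crux of the route (K1 21580 / K2 21581) is proved by it.

WHAT. `psUntwistedLFunctionAtThree_of_print`: C1 follows from modularity (`nonempty_modularParametrizationData`),
Carayol's level theorem (`IsNewformOf.level_eq_conductorNorm`), Gross–Zagier I.(7.3) (`GrossZagier1986_thm_I_7_3`),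
Gross–Zagier–Kolyvagin (`PublishedInputGZK`, route item 19921), Deligne's `ℓ`-adic representations of `Γ₁`-newforms
(`Hida2000_thm326_exists_galoisRep`) and Carayol 1986 Thm. (A) in Euler-factor form (`Carayol1986_eulerFactor`) —
and NOTHING ELSE: the Galois wildness binder of capstone (i) (`PSC1OfPrint.psUntwistedLFunctionAtThree_of_print_of_wild`,
p650696) is discharged on every principal-series row by cycu-p3 g10's
`InertiaWildAtThree.hwild_two_eq_four_of_classO6_of_print` (p650778/p651051; from Deligne + Carayol + the newform
of `W` at level `N_W`, no Artin-conductor fact), the newform being supplied by modularity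
(`ModularParametrizationData.f`, `.isNewformOf` at level `W.conductorNorm ℤ`).

The chain underneath (all ✓, `--supports 27548`): lead files `CoinvariantEigenvalue` p646654,
`InertiaOverCyclotomicNine` p647742, `NineCharacter` p648344, `UntwistFrame` p649180, `UntwistDatum` p649527,
`UniformRootLaw` p650112 (the UNIFORM ROOT LAW `a₃(g₀)² − a_w(W)·a₃(g₀) + 3 = 0`), `PSC1OfPrint` p650696;
cycu-p4 g12 `Gamma1EigenpacketSpan` p648514, `PSStabilisedTwistOldforms` p648845, `…C1` p649231,
`PSC1OfUniformRootLaw` p649627, `Gamma1NewformRigidity` p650146; cycu-p3 g10 `InertiaWildAtThreeLevel` p650027,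
`…Transport` p650129, `InertiaWildAtThree` p650778/p651051; and the Literature engine
`map_reverse_charpoly_toInertiaCoinvariants_twist_eq` (`TateModuleTwistNewformEulerFactorsProofs`).
Memo: `Cruxes/PSUntwistedLFunctionAtThree/LAW-T-KERNEL-v1.md`.

References: [cite: CarayolASENS1986, Thm. (A)] · [cite: Hida2000, Thm. 3.26 (1)] · [cite: GrossZagier1986,
Thm. I.(7.3)] · [cite: MazurTateTeitelbaum1986Invent, §I.14] · [cite: BreuilConradDiamondTaylor2001].
-/

noncomputable section

open scoped MatrixGroups NumberField

open CongruenceSubgroup UpperHalfPlane NumberField IsDedekindDomain Field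
  Literature.NumberTheory.EllipticCurves Literature.NumberTheory.EllipticCurves.ModularForms
  Literature.NumberTheory.EllipticCurves.Rank1Residual Literature.NumberTheory.IwasawaTheory
  Literature.NumberTheory.GaloisRepresentations
  Summit.BirchSwinnertonDyer.BirchSwinnertonDyer.Theses.CyclotomicUntwist
  Summit.BirchSwinnertonDyer.Rank1Residual.Additive

-- single-conjunct summit: `Summit.BirchSwinnertonDyer.BirchSwinnertonDyer.…` repeats the name by design
set_option linter.dupNamespace false
set_option autoImplicit false

namespace Summit.BirchSwinnertonDyer.BirchSwinnertonDyer.Theorems.PSC1OfPrint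

/-- **C1 `PSUntwistedLFunctionAtThree` ⟸ six named print facts, by name (CONDITIONAL result).**
Capstone (i) `psUntwistedLFunctionAtThree_of_print_of_wild` with its wildness binder discharged by
`InertiaWildAtThree.hwild_two_eq_four_of_classO6_of_print` (cycu-p3 g10) on the newform of `W` supplied by
`nonempty_modularParametrizationData`. [cite: CarayolASENS1986, Thm. (A)] [cite: Hida2000, Thm. 3.26 (1)]
[cite: GrossZagier1986, Thm. I.(7.3)] [cite: MazurTateTeitelbaum1986Invent, §I.14] -/
theorem psUntwistedLFunctionAtThree_of_print
    (hmod : nonempty_modularParametrizationData)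
    (hlev : ∀ (N : ℕ) [NeZero N], IsNewformOf.level_eq_conductorNorm (N := N))
    (hGZ86 : GrossZagier1986_thm_I_7_3) (hGZK : PublishedInputGZK)
    (hD : Hida2000_thm326_exists_galoisRep) (hC : Carayol1986_eulerFactor) :
    PSUntwistedLFunctionAtThree :=
  psUntwistedLFunctionAtThree_of_print_of_wild hmod hlev hGZ86 hGZK hD hC fun W _ _ hO6 hev hsq => by
    haveI : NeZero (W.conductorNorm ℤ) := ⟨(W.conductorNorm_pos_holds).ne'⟩
    obtain ⟨Dm⟩ := hmod W
    exact InertiaWildAtThree.hwild_two_eq_four_of_classO6_of_print W hD hC hO6 hev hsq Dm.f Dm.isNewformOf rfl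

end Summit.BirchSwinnertonDyer.BirchSwinnertonDyer.Theorems.PSC1OfPrint

end
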